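import Literature.AnabelianGeometry.EtaleTheta.Discharge.Sec4NonVacuity
import Literature.AnabelianGeometry.EtaleTheta.PiNNRatPrimeCoordinates
import Literature.AlgebraicGeometry.Frobenioids.MonoidTransport
import Mathlib.Data.ZMod.Basic
import HarnessLib

/-!
# [EtTh] Def. 3.3 (iii) / 3.6 (i)–(ii): a tempered Frobenioid whose base acts NON-TRIVIALLY on the divisor monoid
# — two cusps swapped by a deck involution (data file of the "Galois-twist" toy)

S. Mochizuki, *The étale theta function and its Frobenioid-theoretic manifestations*, Publ. RIMS **45** (2009)
[MochizukiEtTh2009], Def. 3.3 (iii) p.73, Def. 3.6 (i)/(ii) pp.76–77 (PDF; printed 299, 302–303); S. Mochizuki,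
*The geometry of Frobenioids I* [MochizukiFrdI2008], §0 p.11, Thm. 5.2 p.100.

abc-iut cell, block F (fact-proving wave), seat abc-iut-f-109 (FACT-LIST row F-0492 `BiKummerSetting.Prop43_i`).  Over a
§4 setting whose divisor monoid carries a TRIVIAL `Aut_D`-action (abc-iut-L2-t3's `Toy`, abc-iut-w5-d063's `ToyCov`,
abc-iut-f-111's `ToyGal`) the existence half of [EtTh] Prop. 4.3 (i) holds for trivial reasons (`Div(s'_N)` is fixed by
everything); the necessity of the outer naturality of Def. 4.1 (ii) (`BiKummerSetting.GaloisSurjNatural`) for the typed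
Prop. 4.3 (i) — the converse of this seat's `prop43_i_holds_of_galoisSurjNatural` (`Discharge/Sec4Prop43iHolds.lean`) —
needs a base whose automorphisms MOVE divisors.  PRIOR ART (landed first, 2026-08-26T11:49–11:51Z, and OF RECORD for the
¬∀ half of F-0492): abc-iut-f-111's `ToySwap` (`Discharge/Sec4GaloisSwapToy.lean`, `…SwapToyProp43i.lean`:
two isomorphic Galois objects with `Aut = ℤ/2`, `Φ = (ℚ_{≥0})²` with the swap, `Π ↠ (ℤ/2)²` from the §1 interface,
`ToySwap.not_forall_prop43_i`, `ToySwap.not_galoisSurjNatural`).  This model-construction file («post-freeze class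
(b)»: new path, nothing frozen edited) is a SECOND, independent such tempered Frobenioid of a different shape — a
NON-groupoid torsor base needing only ONE `ℤ/2`-quotient of `Π^tp_X` (`zQuot` mod `2`; `Aut(top) = 1` makes `H_⊙ = Π`):
* the base `D = D₀` (`ToyTwist.Obj`): objects `gen` (a Galois "double covering" with deck involution:
  `End(gen) = Aut(gen) = ℤ/2`) and `top` (`End(top) = 1`), with `Hom(gen, top)` a FREE `ℤ/2`-torsor and
  `Hom(top, gen) = ∅` — connected, totally epimorphic (REAL);
* `Φ₀ = Φ₀^ℝ = Φ := ∏_{ℤ/2} ℚ_{≥0}` (abc-iut's `PiNNRat` toolkit: divisorial, perfect, sharp), the pull-back along a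
  morphism being TRANSLATION OF THE CUSP INDEX by its `ℤ/2`-label (`ΦR`, `act`) — so the deck involution `t`
  swaps the two cusps `[0]`, `[1]`;
* `B₀ = B₀^Λ := Φ^gp`, `Div := id` (every divisor class is the divisor of a "function"), `F₀ = F₀^Λ = ℝ·Φ₀^cnst :=` the
  classes with equal cusp-coordinates (stable, root-closed — REAL), so that `Φ^{bs-fld} =` the constant effective
  divisors `≅ ℚ_{≥0}` is `ℚ`-monoprime (Def. 3.6 (ii)(a), REAL) and the constant `(1,1)` has a non-zero divisor
  ((b), REAL); monoid type `ℤ`; the [FrdI] vocabularies are the trivial ones (`Toy.monoidVocab`, `catVocab`).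
The §4 setting on top of it (`BiKummerSetting.mk` with free birational vocabulary, `A_⊙ := (top, 0)`), a `1`-st root
with `Div(s'_1) = [0]`, and a second proof of `¬ ∀ S pullFrac, Prop43_i S pullFrac` were kernel-checked on the farm
(cell staging `HOME/staging/f/f-109/Sec4GaloisTwistToy_COMBINED_scratch.lean`, rc 0, standard axioms) but are NOT
filed: the theorem of record is `ToySwap.not_forall_prop43_i` (p442909) and a duplicate would add nothing.
HONEST LABEL: a CONSISTENCY / INDEPENDENCE witness for the typed interfaces (degenerate arithmetic: two cusps, all
"functions" principal); NOT the tempered Frobenioid of a curve; nothing here bears on [IUTchIII] Cor. 3.12; no side taken.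
-/

noncomputable section

namespace Literature.AnabelianGeometry.EtaleTheta

open CategoryTheory Opposite Literature.AlgebraicGeometry.Frobenioids
open scoped NNRat

namespace ToyTwist

/-! ### The base category: one Galois object `gen` with `Aut = ℤ/2`, and `top` with `Aut = 1`, `Hom(gen, top)` a
`ℤ/2`-torsor, `Hom(top, gen) = ∅` -/

/-- The objects of the base category `D`: `gen` (think: an étale double covering with its deck involution) and
`top` (rigid). [cite: MochizukiEtTh2009, Def 3.6 p.76] -/
inductive Obj : Type
  | gen
  | top
  deriving DecidableEq

namespace Obj

/-- Morphisms: `End(gen) = Hom(gen, top) = ℤ/2` (written multiplicatively), `End(top) = 1`, `Hom(top, gen) = ∅`.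
[cite: MochizukiEtTh2009, Def 3.6 p.76] -/
@[reducible] def Hom : Obj → Obj → Type
  | gen, gen => Multiplicative (ZMod 2)
  | gen, top => Multiplicative (ZMod 2)
  | top, top => PUnit
  | top, gen => PEmpty

/-- The `ℤ/2`-label ("degree") of a morphism (`1` on `End(top)`). [cite: MochizukiEtTh2009, Def 3.6 p.76] -/
@[reducible] def deg : ∀ {X Y : Obj}, Hom X Y → Multiplicative (ZMod 2)
  | gen, gen, m => m
  | gen, top, m => m
  | top, top, _ => 1
  | top, gen, e => e.elim

/-- Composition: labels multiply. [cite: MochizukiEtTh2009, Def 3.6 p.76] -/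
@[reducible] def comp : ∀ {X Y Z : Obj}, Hom X Y → Hom Y Z → Hom X Z
  | gen, gen, gen, m, n => (show Multiplicative (ZMod 2) from m) * (show Multiplicative (ZMod 2) from n)
  | gen, gen, top, m, n => (show Multiplicative (ZMod 2) from m) * (show Multiplicative (ZMod 2) from n)
  | gen, top, top, m, _ => m
  | top, top, top, _, _ => PUnit.unit
  | top, gen, _, e, _ => e.elim
  | gen, top, gen, _, e => e.elim
  | top, top, gen, _, e => e.elim

/-- `D` is a category. [cite: MochizukiEtTh2009, Def 3.6 p.76] -/
instance instSmallCategory : SmallCategory Obj where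
  Hom := Hom
  id X := match X with
    | gen => (1 : Multiplicative (ZMod 2))
    | top => PUnit.unit
  comp f g := comp f g
  id_comp := by
    rintro (_ | _) (_ | _) f
    · exact one_mul (M := Multiplicative (ZMod 2)) f
    · exact one_mul (M := Multiplicative (ZMod 2)) f
    · exact f.elim
    · rfl
  comp_id := by
    rintro (_ | _) (_ | _) f
    · exact mul_one (M := Multiplicative (ZMod 2)) f
    · rfl
    · exact f.elim
    · rfl
  assoc := by
    rintro (_ | _) (_ | _) (_ | _) (_ | _) f g h <;>
      first
      | exact mul_assoc (G := Multiplicative (ZMod 2)) f g h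
      | rfl
      | exact f.elim
      | exact g.elim
      | exact h.elim

/-- The degree of an identity is `1`. [cite: MochizukiEtTh2009, Def 3.6 p.76] -/
theorem deg_id (X : Obj) : deg (𝟙 X) = 1 := by cases X <;> rfl

/-- The degree is multiplicative. [cite: MochizukiEtTh2009, Def 3.6 p.76] -/
theorem deg_comp {X Y Z : Obj} (f : X ⟶ Y) (g : Y ⟶ Z) : deg (f ≫ g) = deg f * deg g := by
  cases X <;> cases Y <;> cases Z <;>
    first
    | rfl
    | exact (mul_one _).symm
    | exact f.elim
    | exact g.elim

/-- The involution `t ∈ Aut(gen)` (the deck transformation). [cite: MochizukiEtTh2009, Def 3.6 p.76] -/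
def t : gen ⟶ gen := (Multiplicative.ofAdd 1 : Multiplicative (ZMod 2))

/-- `deg t = [1]`. [cite: MochizukiEtTh2009, Def 3.6 p.76] -/
theorem deg_t : deg t = Multiplicative.ofAdd 1 := rfl

/-- A chosen morphism `y₀ : gen → top` (label `0`). [cite: MochizukiEtTh2009, Def 3.6 p.76] -/
def y₀ : gen ⟶ top := (1 : Multiplicative (ZMod 2))

/-- `deg y₀ = 1`. [cite: MochizukiEtTh2009, Def 3.6 p.76] -/
theorem deg_y₀ : deg y₀ = 1 := rfl

/-- `t ≫ y₀ ≠ y₀`: the deck involution does NOT lie over `top` through `y₀` (the torsor is free).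
[cite: MochizukiEtTh2009, Def 3.6 p.76] -/
theorem t_comp_y₀_ne : t ≫ y₀ ≠ y₀ := by
  show (Multiplicative.ofAdd (1 : ZMod 2) * 1 : Multiplicative (ZMod 2)) ≠ 1
  rw [mul_one]
  decide

/-- Endomorphisms of `top` are trivial. [cite: MochizukiEtTh2009, Def 3.6 p.76] -/
theorem hom_top_top_eq (f g : top ⟶ top) : f = g := rfl

/-- `D` is connected. [cite: MochizukiEtTh2009, Def 3.6 p.77] -/
theorem isConnected : IsConnected Obj := by
  haveI : Nonempty Obj := ⟨gen⟩
  refine zigzag_isConnected fun j₁ j₂ => ?_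
  rcases j₁ with _ | _ <;> rcases j₂ with _ | _
  · exact Relation.ReflTransGen.refl
  · exact Zigzag.of_hom y₀
  · exact Zigzag.of_inv y₀
  · exact Relation.ReflTransGen.refl

/-- `D` is totally epimorphic. [cite: MochizukiEtTh2009, Def 3.6 p.77] -/
theorem isTotallyEpimorphic : IsTotallyEpimorphic Obj := by
  refine ⟨fun {A B} f => ⟨fun {Z} g h w => ?_⟩⟩
  rcases A with _ | _ <;> rcases B with _ | _ <;> rcases Z with _ | _
  · have w' : (show Multiplicative (ZMod 2) from f) * (show Multiplicative (ZMod 2) from g) =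
        (show Multiplicative (ZMod 2) from f) * (show Multiplicative (ZMod 2) from h) := w
    have w'' := mul_left_cancel w'
    exact w''
  · have w' : (show Multiplicative (ZMod 2) from f) * (show Multiplicative (ZMod 2) from g) =
        (show Multiplicative (ZMod 2) from f) * (show Multiplicative (ZMod 2) from h) := w
    have w'' := mul_left_cancel w'
    exact w''
  · exact g.elim
  · rfl
  · exact f.elim
  · exact f.elim
  · exact g.elim
  · rfl

end Obj

open Obj

/-! ### The divisor monoid `Φ = ℚ_{≥0} × ℚ_{≥0}` (two cusps indexed by `ℤ/2`), the deck group acting by translation -/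

/-- `M := ∏_{ℤ/2} ℚ_{≥0}`, the (perfect) monoid of effective `ℚ`-divisors supported on two cusps.
[cite: MochizukiEtTh2009, Def 3.3 p.73] -/
abbrev M : Type := ZMod 2 → Multiplicative ℚ≥0

/-- The action of `d ∈ ℤ/2` on `M` by translating the cusp index. [cite: MochizukiEtTh2009, Def 3.6 p.76] -/
def act (d : Multiplicative (ZMod 2)) : M →* M where
  toFun m := fun i => m (i + Multiplicative.toAdd d)
  map_one' := rfl
  map_mul' _ _ := rfl

/-- `act d m i = m (i + d)`. [cite: MochizukiEtTh2009, Def 3.6 p.76] -/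
@[simp] theorem act_apply (d : Multiplicative (ZMod 2)) (m : M) (i : ZMod 2) :
    act d m i = m (i + Multiplicative.toAdd d) := rfl

/-- `act 1 = id`. [cite: MochizukiEtTh2009, Def 3.6 p.76] -/
theorem act_one : act 1 = MonoidHom.id M := by
  ext m i
  simp

/-- `act (d e) = act d ∘ act e`. [cite: MochizukiEtTh2009, Def 3.6 p.76] -/
theorem act_mul (d e : Multiplicative (ZMod 2)) : act (d * e) = (act d).comp (act e) := by
  ext m i
  simp [add_assoc, add_comm (Multiplicative.toAdd d)]

/-- **`Φ₀ = Φ₀^ℝ := (Y ↦ ∏_{ℤ/2} ℚ_{≥0})` as a monoid on `D`**, pull-back along a morphism = translation by its degree.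
[cite: MochizukiEtTh2009, Def 3.6 p.76] -/
def ΦR : Objᵒᵖ ⥤ CommMonCat.{0} where
  obj _ := CommMonCat.of M
  map f := CommMonCat.ofHom (act (deg f.unop))
  map_id X := by
    apply CommMonCat.hom_ext
    rw [CommMonCat.hom_ofHom, CommMonCat.hom_id, unop_id, deg_id, act_one]
  map_comp f g := by
    apply CommMonCat.hom_ext
    rw [CommMonCat.hom_ofHom, CommMonCat.hom_comp, CommMonCat.hom_ofHom, CommMonCat.hom_ofHom, unop_comp, deg_comp,
      act_mul]

/-- The pull-back of `ΦR` along `f` is `act (deg f)`. [cite: MochizukiEtTh2009, Def 3.6 p.76] -/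
theorem ΦR_map_hom {X Y : Objᵒᵖ} (f : X ⟶ Y) : (ΦR.map f).hom = act (deg f.unop) := rfl

/-! ### Constant divisors `ℝ·Φ₀^cnst := {ξ | all coordinates equal}` and its stability -/

/-- `c_i (Φ(f) ξ) = c_{i + deg f}(ξ)`: coordinates of a translated class. [cite: MochizukiFrdI2008, Def. 2.4(i) p.47] -/
theorem c_gpMap_act (d : Multiplicative (ZMod 2)) (i : ZMod 2) (ξ : Algebra.GrothendieckGroup M) :
    PiNNRat.c i (gpMap (act d) ξ) = PiNNRat.c (i + Multiplicative.toAdd d) ξ := by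
  have h : (PiNNRat.cQ i).comp (gpMap (act d)) = PiNNRat.cQ (ι := ZMod 2) (i + Multiplicative.toAdd d) := by
    apply MonGp.hom_ext
    intro m
    rw [MonoidHom.comp_apply, gpMap_of, PiNNRat.cQ_of, PiNNRat.cQ_of]
    rfl
  exact congrArg Multiplicative.toAdd (DFunLike.congr_fun h ξ)

/-- **`ℝ·Φ₀^cnst`**: the classes all of whose cusp-coordinates agree (a subgroup of `(Φ₀^ℝ)^gp`).
[cite: MochizukiEtTh2009, Def 3.6 p.76] -/
def cnstR : Subgroup (Algebra.GrothendieckGroup M) :=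
  ⨅ i : ZMod 2, ⨅ j : ZMod 2, (PiNNRat.cQ (ι := ZMod 2) i).eqLocus (PiNNRat.cQ j)

/-- Membership in `ℝ·Φ₀^cnst`. [cite: MochizukiEtTh2009, Def 3.6 p.76] -/
theorem mem_cnstR_iff (ξ : Algebra.GrothendieckGroup M) : ξ ∈ cnstR ↔ ∀ i j, PiNNRat.c i ξ = PiNNRat.c j ξ := by
  simp only [cnstR, Subgroup.mem_iInf]
  refine ⟨fun h i j => congrArg Multiplicative.toAdd (h i j), fun h i j => ?_⟩
  exact Multiplicative.toAdd.injective (h i j)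

/-- `ℝ·Φ₀^cnst` is stable under pull-back. [cite: MochizukiEtTh2009, Def 3.6 p.76] -/
theorem gpMap_act_mem_cnstR (d : Multiplicative (ZMod 2)) {ξ : Algebra.GrothendieckGroup M} (h : ξ ∈ cnstR) :
    gpMap (act d) ξ ∈ cnstR := by
  rw [mem_cnstR_iff] at h ⊢
  intro i j
  rw [c_gpMap_act, c_gpMap_act]
  exact h _ _

/-- `ℝ·Φ₀^cnst` is root-closed (`ℚ` is torsion-free). [cite: MochizukiEtTh2009, Def 3.6 p.76] -/
theorem mem_cnstR_of_pow {ξ : Algebra.GrothendieckGroup M} {n : ℕ} (hn : n ≠ 0) (h : ξ ^ n ∈ cnstR) : ξ ∈ cnstR := by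
  rw [mem_cnstR_iff] at h ⊢
  intro i j
  have h1 := h i j
  rw [← zpow_natCast, PiNNRat.c_zpow, PiNNRat.c_zpow] at h1
  have hn' : ((n : ℤ) : ℚ) ≠ 0 := by exact_mod_cast hn
  exact mul_left_cancel₀ hn' h1

/-- The class of the constant divisor `(q, q)` is constant. [cite: MochizukiEtTh2009, Def 3.6 p.76] -/
theorem of_const_mem_cnstR (q : Multiplicative ℚ≥0) : Algebra.GrothendieckGroup.of (fun _ : ZMod 2 => q) ∈ cnstR := by
  rw [mem_cnstR_iff]
  intro i j
  rw [PiNNRat.c_of, PiNNRat.c_of]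

/-! ### The data of Def. 3.3 (iii) / 3.6 (i): `B₀ = B₀^Λ := Φ^gp` (every class is the divisor of a "function"),
`F₀ = F₀^Λ :=` the constant classes -/

/-- `gpMap` of the identity, pointwise. [folklore] -/
private theorem gpMap_id_apply {N : Type} [CommMonoid N] (x : Algebra.GrothendieckGroup N) :
    gpMap (MonoidHom.id N) x = x :=
  DFunLike.congr_fun (Literature.AlgebraicGeometry.Frobenioids.gpMap_id (M := N)) x

/-- **Def 3.3 (iii) data**: `Φ₀ := ∏_{ℤ/2} ℚ_{≥0}` with the translation action, `B₀ := Φ₀^gp`, `div₀ := id`,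
`F₀ :=` the constant classes; everything non-cuspidal. [cite: MochizukiEtTh2009, Def 3.3 p.73] -/
def divisorMonoids : DivisorMonoids.{0, 0, 0} Obj where
  Φ₀ := ΦR
  B₀ := monoidGp ΦR
  isUnit_B₀ _ b := by
    change IsUnit (M := Algebra.GrothendieckGroup M) b
    exact Group.isUnit _
  div₀ _ := MonoidHom.id _
  div₀_natural _ _ := rfl
  F₀ _ := cnstR.toSubmonoid
  F₀_map f _ hb := gpMap_act_mem_cnstR (deg f.unop) hb
  ncsp₀ _ := ⊤
  csp₀ _ := ⊥
  ncsp₀_map _ _ _ := trivial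
  csp₀_map _ x hx := by
    rw [Submonoid.mem_bot] at hx ⊢
    rw [hx, map_one]
  existsUnique_ncsp_csp _ x := by
    refine ⟨(⟨x, trivial⟩, ⟨1, Submonoid.mem_bot.mpr rfl⟩), mul_one x, ?_⟩
    rintro ⟨a, c⟩ h
    have hc : c.1 = 1 := Submonoid.mem_bot.mp c.2
    have ha : a.1 = x := by
      have h' : a.1 * c.1 = x := h
      rwa [hc, mul_one] at h'
    exact Prod.ext (Subtype.ext ha) (Subtype.ext hc)

/-- **Def 3.6 (i) data** (`Λ = ℤ`, `Φ₀^ℝ = Φ₀`, `B₀^Λ = B₀ = Φ₀^gp`, `ℝ·Φ₀^cnst =` the constant classes), over the trivial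
[FrdI] monoid vocabulary. [cite: MochizukiEtTh2009, Def 3.6 p.76] -/
def realified : RealifiedDivisorMonoids (D₀ := Obj) Toy.monoidVocab where
  toDivisorMonoids := divisorMonoids
  Λ := MonoidType.Z
  ΦR := ΦR
  toR _ := MonoidHom.id _
  toR_natural _ _ := rfl
  isRealification _ := trivial
  BΛ := monoidGp ΦR
  isUnit_BΛ _ b := by
    change IsUnit (M := Algebra.GrothendieckGroup M) b
    exact Group.isUnit _
  divΛ _ := MonoidHom.id _
  divΛ_natural _ _ := rfl
  FΛ _ := cnstR.toSubmonoid
  FΛ_map f _ hb := gpMap_act_mem_cnstR (deg f.unop) hb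
  cnstR _ := cnstR
  cnstR_map f _ hx := gpMap_act_mem_cnstR (deg f.unop) hx
  divΛ_mem_cnstR _ _ hb := hb
  cnstR_root _ _ n hg := mem_cnstR_of_pow n.ne_zero hg
  cnst_le_cnstR _ b hb := by
    change gpMap (MonoidHom.id M) b ∈ cnstR
    rw [gpMap_id_apply]
    exact hb
  ncspR _ := ⊤
  cspR _ := ⊥
  toR_ncsp _ _ _ := trivial
  toR_csp _ _ hx := hx

/-! ### `Φ^{bs-fld} = Φ ∩ ℝ·Φ₀^cnst` = the constant effective divisors `≅ ℚ_{≥0}`: monoprime -/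

/-- The submonoid of constant effective divisors (`Φ^{bs-fld}` of the toy at every object).
[cite: MochizukiEtTh2009, Def 3.6 p.77] -/
abbrev bsFldSub : Submonoid M := ⊤ ⊓ cnstR.toSubmonoid.comap (Algebra.GrothendieckGroup.of (M := M))

/-- An effective divisor lies in `Φ^{bs-fld}` iff its two coordinates agree. [cite: MochizukiEtTh2009, Def 3.6 p.77] -/
theorem mem_bsFldSub_iff (x : M) : x ∈ bsFldSub ↔ ∀ i j, x i = x j := by
  rw [Submonoid.mem_inf, Submonoid.mem_comap, Subgroup.mem_toSubmonoid, mem_cnstR_iff]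
  simp only [Submonoid.mem_top, true_and, PiNNRat.c_of, NNRat.coe_inj]
  exact ⟨fun h i j => Multiplicative.toAdd.injective (h i j), fun h i j => congrArg _ (h i j)⟩

/-- **`Φ^{bs-fld} ≅ ℚ_{≥0}`** (evaluation at a cusp). [cite: MochizukiEtTh2009, Def 3.6 p.77] -/
def bsFldEquiv : ↥bsFldSub ≃* Multiplicative ℚ≥0 where
  toFun x := x.1 0
  invFun q := ⟨fun _ => q, (mem_bsFldSub_iff _).2 fun _ _ => rfl⟩
  left_inv x := Subtype.ext (funext fun i => ((mem_bsFldSub_iff x.1).1 x.2 i 0).symm)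
  right_inv _ := rfl
  map_mul' _ _ := rfl

/-- `Φ^{bs-fld}` of the toy is (`ℚ`-)monoprime. [cite: MochizukiEtTh2009, Def 3.6 p.77] -/
theorem isMonoprime_bsFldSub : IsMonoprime ↥bsFldSub := IsMonoprime.ofQ ⟨⟨bsFldEquiv⟩⟩

/-! ### Def. 3.6 (ii): the tempered Frobenioid of the toy -/

/-- The trivial [FrdI] category vocabulary on `D`. [cite: MochizukiEtTh2009, Def 3.6 p.77] -/
def catVocab : FrdICatStub.{0, 0, 0} Obj where
  IsDivisorialOn _ := True
  IsRational _ := True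
  IsStrictlyRational _ := True

/-- The constant "function" `𝟙 := [(1,1)] ∈ F` with non-zero (constant) divisor. [cite: MochizukiEtTh2009, Def 3.6 p.77] -/
def oneOne : M := fun _ => Multiplicative.ofAdd 1

/-- `(1,1) ≠ 0`. [cite: MochizukiEtTh2009, Def 3.6 p.77] -/
theorem oneOne_ne_one : oneOne ≠ 1 := by
  intro h
  have h1 := congrFun h 0
  exact one_ne_zero (Multiplicative.ofAdd.injective h1)

/-- **Def. 3.6 (ii) for the toy**: `D` the torsor category, `Φ := Φ^{ℝ-log} = ∏_{ℤ/2} ℚ_{≥0}` with the deck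
involution SWAPPING the two cusps; `Φ^{bs-fld} =` constants, monoprime (REAL); (b) the constant `(1,1)` has a
non-zero divisor (REAL). [cite: MochizukiEtTh2009, Def 3.6 p.77] -/
def tf : TemperedFrobenioid realified Obj catVocab where
  isConnected := Obj.isConnected
  isTotallyEpimorphic := Obj.isTotallyEpimorphic
  base := 𝟭 _
  Φ := ⟨fun _ => ⊤, fun _ _ _ => trivial⟩
  isGroupSaturated A := (isGroupSaturated_iff' _).2 fun _ _ _ _ _ _ => trivial
  isPerfFactorial _ := trivial
  isDivisorialOn := trivial
  isMonoprime_bsFld _ := isMonoprime_bsFldSub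
  exists_FΛ_div_ne _ := ⟨Algebra.GrothendieckGroup.of oneOne, of_const_mem_cnstR _, oneOne, trivial, 1, trivial,
    oneOne_ne_one, by rw [map_one, div_one]; rfl⟩

end ToyTwist

end Literature.AnabelianGeometry.EtaleTheta

end
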